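import Summits.NavierStokesRegularity.FluidComputer.PalasekTowerLundgrenChildEntropyClock
import Literature.Analysis.FluidPDE.PlanarVorticityEntropyNonneg

/-!
# REGISTER v2.3″ (continued): THE ENTROPY CLOCK NEEDS ONLY CO-SIGNEDNESS — the `L¹` relaxation of a
# Lundgren-carried child core to the Burgers vortex for EVERY non-negative cross-section

Cell `ns-blowup`, seat `ns-blowup-ecbridge-8` (g10); evidence toward crux 20305 `HeredityFromTwoT`
(standing record 19250 `HeredityFromTwo`; faces `stub_speed_floors` / `stub_core_floors`) of route
`PalasekTowerBreakdown`, in the MODEL lane and with the MODEL IDENTIFICATION of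
`PalasekTowerLundgrenChildLaws` («child core = cross-section of Lundgren's stretched flow in the host
strain `c = λA_k` at `ν = 1`», cross-section circulation `Γ`). The g9 file
`PalasekTowerLundgrenChildEntropyClock` typed the entropy clock for the class of POSITIVE, LOG-TAME
cross-sections (`0 < ω̃`, `|log ω̃| ≤ L(1+‖η‖)^m`, `‖∇ω̃‖ ≤ L(1+‖η‖)^m ω̃` at ALL planar times —
refuter4 K197 rider R2: the log-Lipschitz clause "is the least standard of the three … a Li–Yau-type
claim not in print"). With the Literature theorem
`IsClassicalNSSolutionOn.relEntropy_mul_le_of_nonneg` / `…integral_abs_planarVorticity_sub_gaussian_le_of_nonneg`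
(`PlanarVorticityEntropyNonneg`: Gallay–Wayne 2005 Lemma 3.2 + §3.4 for NON-NEGATIVE data, by
regularisation `θ_ε = ω̃ + ε((1+‖η‖²)³)⁻¹` and `ε → 0⁺`) the three hypotheses are replaced by the single
hand-over condition **`ω̃(0) ≥ 0` with `Γ = ∫ ω̃(0) > 0`** (co-signed cross-section; non-negativity then
propagates by the tree's minimum principle):

* `palasekTowerBreakdown_cosigned_relEntropy_clock` — `H(τ(s)) ≤ H(0) · e^{−λA_k s}`;
* `palasekTowerBreakdown_cosigned_L1_clock` — `∫ |ω̃(τ(s)) − g_{τ(s)}| ≤ (2ΓH(0))^{1/2} e^{−λA_k s/2}`;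
* `palasekTowerBreakdown_cosigned_L1_clock_threshold` — after `e^{λA_k s} ≥ 2ΓH(0)/ε²` the `L¹`
  defect is `≤ ε`;
* `palasekTowerBreakdown_cosigned_childVorticity_L1_burgers_clock` — the 3D reading on every
  cross-section `{x₂ = z₀}`: `∫ |ω_z(s, ·, z₀) − ω_Burgers| dy ≤ (2ΓH(0))^{1/2} e^{−λA_k s/2}`.

The statements and proofs are those of the g9 file VERBATIM with `hpos`/`hlog`/`hsc` deleted and
`h0nn : 0 ≤ ω̃(0)`, `hΓ : 0 < ∫ ω̃(0)` added; `H(0) = ∫ ω̃(0) log(ω̃(0)/g_0)` with `0 log 0 = 0`.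

READING for 20305/19250 (numbers, not adjectives): the any-profile child-core clock
`s_ε = λA_k⁻¹ log(2ΓH(0)/ε²)` of the g9 register rows (L¹ face; and through
`PalasekTowerLundgrenChildSwirlRelaxation` / `…CoreClock` / `…SwirlBurgersBracket` the speed and core
faces, whose positive-class hypotheses can be traded the same way) holds for EVERY CO-SIGNED hand-over
cross-section in the uniform rapid-decay class; the only datum is `H(0)`, finite for every bounded
non-negative rapidly decaying slice (`|ω log ω| ≤ 2√ω + ω²`).

WHAT THIS IS NOT: not NS about any registered flow — exact INFINITE-ENERGY Lundgren flows, no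
registered stage; nothing is asserted about `AprioriCeiling`, `WindowCeilingAt`, `ReadoutFloors` or
any crux; the identification «child core = Lundgren cross-section» is a MODEL step; sign-changing
cross-sections remain out of scope (Gallay–Wayne's general `L¹` convergence has no rate).

References: Th. Gallay, C. E. Wayne, Comm. Math. Phys. 255 (2005), Lemma 3.2, §3.4
[cite: GallayWayne2005, Lemma 3.2 and §3.4]; P. G. Saffman, *Vortex Dynamics*, CUP 1992, §13.3
(26)–(31) [cite: Saffman1992, §13.3 eqs. (26)–(31)]; S. Palasek, arXiv:2605.13827, §3 (3.2)
[cite: Palasek2026ElementaryModel, §3 (3.2)].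
-/

namespace Summit.NavierStokesRegularity.FluidComputer.PalasekTowerClayBridge

open Real Set MeasureTheory
open Literature.Analysis.FluidPDE Literature.Analysis.FluidPDE.Lundgren

variable {S S' : Set ℝ}
  {v : ℝ → EuclideanSpace ℝ (Fin 2) → EuclideanSpace ℝ (Fin 2)}
  {q : ℝ → EuclideanSpace ℝ (Fin 2) → ℝ} {w : ℝ → EuclideanSpace ℝ (Fin 2) → ℝ}

/-! ### §0 Clock algebra -/

/-- The scalar vorticity of the zero planar field vanishes. [folklore] -/
private theorem planarVorticity_zero_force₀ (σ : ℝ) (η : EuclideanSpace ℝ (Fin 2)) :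
    PlanarEigenmode.vorticity ((0 : ℝ → EuclideanSpace ℝ (Fin 2) → EuclideanSpace ℝ (Fin 2)) σ) η
      = 0 := by
  rw [Pi.zero_apply, PlanarEigenmode.vorticity_def,
    show (0 : EuclideanSpace ℝ (Fin 2) → EuclideanSpace ℝ (Fin 2)) = fun _ => 0 from rfl]
  simp

/-- Lundgren's clock with the virtual origin `1/c`: `(e^{cs} − 1)/c + c⁻¹ = e^{cs}/c`. [folklore] -/
private theorem clock_add_inv₀ {c : ℝ} (hc : c ≠ 0) (s : ℝ) :
    (exp (c * s) - 1) / c + c⁻¹ = exp (c * s) / c := by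
  field_simp
  ring

/-- `c⁻¹ / (e^{cs}/c) = e^{−cs}`. [folklore] -/
private theorem inv_div_clock₀ {c : ℝ} (hc : c ≠ 0) (s : ℝ) :
    c⁻¹ / (exp (c * s) / c) = exp (-(c * s)) := by
  rw [Real.exp_neg]
  field_simp

/-- `√(e^{−cs}) = e^{−cs/2}`. [folklore] -/
private theorem sqrt_exp_neg₀ (c s : ℝ) : Real.sqrt (exp (-(c * s))) = exp (-(c * s / 2)) := by
  have h : exp (-(c * s)) = exp (-(c * s / 2)) ^ 2 := by
    rw [sq, ← Real.exp_add]; ring_nf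
  rw [h, Real.sqrt_sq (exp_pos _).le]

/-! ### §1 The entropy clock for a co-signed cross-section -/

/-- **THE ENTROPY CLOCK, CO-SIGNED CLASS** (`ν = 1`, host strain `c = λA_k`; MODEL lane). Let the
child's cross-section be a classical unforced planar Navier–Stokes run `(ṽ, q̃)` on a convex
planar-time set `S'` (`ṽ = K₂ ∗ ω̃`, uniformly rapidly decaying vorticity) with `0 ∈ S'` (the hand-over
slice), **`ω̃(0) ≥ 0` and `Γ = ∫ ω̃(0) > 0`** — no positivity or log-tameness at later times; let
`g_τ = Γ (4π(τ + c⁻¹))⁻¹ e^{−‖η‖²/(4(τ + c⁻¹))}` (in Lundgren's variables the steady Burgers profile,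
`burgersVorticity_eq_lundgren_gaussian`) and `H(τ) = ∫ ω̃(τ) log(ω̃(τ)/g_τ)` (`0 log 0 = 0`). Then for
every strain time `s ≥ 0` whose Lundgren time `τ(s) = (e^{cs} − 1)/c` lies in `S'`:
**`H(τ(s)) ≤ H(0) · e^{−cs}`** (`IsClassicalNSSolutionOn.relEntropy_mul_le_of_nonneg` at `t₀ = 0`,
`t⋆ = c⁻¹`). -/
theorem palasekTowerBreakdown_cosigned_relEntropy_clock (R : TowerRates) (k : ℕ)
    {l : ℝ} (hl : 0 < l) (hS' : Convex ℝ S') (hv : IsClassicalNSSolutionOn S' 1 0 v q)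
    (hω : HasUniformRapidDecayOn S' (fun σ η => PlanarEigenmode.vorticity (v σ) η))
    (hBS : ∀ σ ∈ S', ∀ η, v σ η = biotSavart2D (PlanarEigenmode.vorticity (v σ)) η)
    (h0 : (0 : ℝ) ∈ S') (h0nn : ∀ η, 0 ≤ PlanarEigenmode.vorticity (v 0) η)
    (hΓ : 0 < ∫ y, PlanarEigenmode.vorticity (v 0) y) {s : ℝ} (hs : 0 ≤ s)
    (hτs : (exp (l * R.A k * s) - 1) / (l * R.A k) ∈ S') :
    (∫ η, PlanarEigenmode.vorticity (v ((exp (l * R.A k * s) - 1) / (l * R.A k))) η *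
        Real.log (PlanarEigenmode.vorticity (v ((exp (l * R.A k * s) - 1) / (l * R.A k))) η /
          ((∫ y, PlanarEigenmode.vorticity (v 0) y) /
              (4 * π * ((exp (l * R.A k * s) - 1) / (l * R.A k) + (l * R.A k)⁻¹)) *
            exp (-(‖η‖ ^ 2 / (4 * ((exp (l * R.A k * s) - 1) / (l * R.A k) + (l * R.A k)⁻¹))))))) ≤
      (∫ η, PlanarEigenmode.vorticity (v 0) η *
        Real.log (PlanarEigenmode.vorticity (v 0) η /
          ((∫ y, PlanarEigenmode.vorticity (v 0) y) / (4 * π * (l * R.A k)⁻¹) *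
            exp (-(‖η‖ ^ 2 / (4 * (l * R.A k)⁻¹)))))) * exp (-(l * R.A k * s)) := by
  set c : ℝ := l * R.A k with hc
  have hcpos : 0 < c := mul_pos hl (R.A_pos k)
  have hcurl : ∀ σ ∈ S', ∀ η, PlanarEigenmode.vorticity
      ((0 : ℝ → EuclideanSpace ℝ (Fin 2) → EuclideanSpace ℝ (Fin 2)) σ) η = 0 :=
    fun σ _ η => planarVorticity_zero_force₀ σ η
  have hτ0 : (0 : ℝ) ≤ (exp (c * s) - 1) / c :=
    div_nonneg (by linarith [one_le_exp (mul_nonneg hcpos.le hs)]) hcpos.le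
  have h := hv.relEntropy_mul_le_of_nonneg hS' one_pos hω hBS hcurl h0 hτs hτ0
    (tstar := c⁻¹) (inv_pos.2 hcpos) h0nn hΓ
  simp only [mul_one, sub_zero] at h
  -- `H(τ(s)) · e^{cs}/c ≤ H(0) · c⁻¹`
  rw [clock_add_inv₀ hcpos.ne'] at h ⊢
  have h2 := (le_div_iff₀ (div_pos (exp_pos (c * s)) hcpos)).2 h
  rwa [mul_div_assoc, inv_div_clock₀ hcpos.ne'] at h2

/-! ### §2 The `L¹` clock -/

/-- **THE `L¹` CLOCK, CO-SIGNED CLASS** (same setting):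
**`∫ |ω̃(τ(s)) − g_{τ(s)}| ≤ (2 Γ H(0))^{1/2} · e^{−cs/2}`**
(`IsClassicalNSSolutionOn.integral_abs_planarVorticity_sub_gaussian_le_of_nonneg` at `t₀ = 0`,
`t⋆ = c⁻¹`). -/
theorem palasekTowerBreakdown_cosigned_L1_clock (R : TowerRates) (k : ℕ)
    {l : ℝ} (hl : 0 < l) (hS' : Convex ℝ S') (hv : IsClassicalNSSolutionOn S' 1 0 v q)
    (hω : HasUniformRapidDecayOn S' (fun σ η => PlanarEigenmode.vorticity (v σ) η))
    (hBS : ∀ σ ∈ S', ∀ η, v σ η = biotSavart2D (PlanarEigenmode.vorticity (v σ)) η)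
    (h0 : (0 : ℝ) ∈ S') (h0nn : ∀ η, 0 ≤ PlanarEigenmode.vorticity (v 0) η)
    (hΓ : 0 < ∫ y, PlanarEigenmode.vorticity (v 0) y) {s : ℝ} (hs : 0 ≤ s)
    (hτs : (exp (l * R.A k * s) - 1) / (l * R.A k) ∈ S') :
    ∫ η, |PlanarEigenmode.vorticity (v ((exp (l * R.A k * s) - 1) / (l * R.A k))) η -
        (∫ y, PlanarEigenmode.vorticity (v 0) y) /
            (4 * π * ((exp (l * R.A k * s) - 1) / (l * R.A k) + (l * R.A k)⁻¹)) *
          exp (-(‖η‖ ^ 2 / (4 * ((exp (l * R.A k * s) - 1) / (l * R.A k) + (l * R.A k)⁻¹))))| ≤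
      Real.sqrt (2 * (∫ y, PlanarEigenmode.vorticity (v 0) y) *
        ∫ η, PlanarEigenmode.vorticity (v 0) η *
          Real.log (PlanarEigenmode.vorticity (v 0) η /
            ((∫ y, PlanarEigenmode.vorticity (v 0) y) / (4 * π * (l * R.A k)⁻¹) *
              exp (-(‖η‖ ^ 2 / (4 * (l * R.A k)⁻¹)))))) * exp (-(l * R.A k * s / 2)) := by
  set c : ℝ := l * R.A k with hc
  have hcpos : 0 < c := mul_pos hl (R.A_pos k)
  have hcurl : ∀ σ ∈ S', ∀ η, PlanarEigenmode.vorticity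
      ((0 : ℝ → EuclideanSpace ℝ (Fin 2) → EuclideanSpace ℝ (Fin 2)) σ) η = 0 :=
    fun σ _ η => planarVorticity_zero_force₀ σ η
  have hτ0 : (0 : ℝ) ≤ (exp (c * s) - 1) / c :=
    div_nonneg (by linarith [one_le_exp (mul_nonneg hcpos.le hs)]) hcpos.le
  have h := hv.integral_abs_planarVorticity_sub_gaussian_le_of_nonneg hS' one_pos hω hBS hcurl h0
    hτs hτ0 (tstar := c⁻¹) (inv_pos.2 hcpos) h0nn hΓ
  simp only [mul_one, sub_zero] at h
  refine h.trans (le_of_eq ?_)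
  rw [clock_add_inv₀ hcpos.ne', mul_div_assoc, inv_div_clock₀ hcpos.ne', Real.sqrt_mul' _ (exp_pos _).le,
    sqrt_exp_neg₀]

/-- **THE CLOCK AS A NUMBER OF STRAIN TIMES, CO-SIGNED CLASS**: for `ε > 0`, once
`e^{cs} ≥ 2ΓH(0)/ε²` (i.e. after `s ≥ λA_k⁻¹ log(2ΓH(0)/ε²)` strain-time units) the `L¹` defect of the
cross-section to the Burgers-normalised Gaussian is `≤ ε`. [cite: GallayWayne2005, §3.4 ("an explicit
upper bound of the time needed for the solution to enter a given neighborhood of the vortex")] -/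
theorem palasekTowerBreakdown_cosigned_L1_clock_threshold (R : TowerRates) (k : ℕ)
    {l : ℝ} (hl : 0 < l) (hS' : Convex ℝ S') (hv : IsClassicalNSSolutionOn S' 1 0 v q)
    (hω : HasUniformRapidDecayOn S' (fun σ η => PlanarEigenmode.vorticity (v σ) η))
    (hBS : ∀ σ ∈ S', ∀ η, v σ η = biotSavart2D (PlanarEigenmode.vorticity (v σ)) η)
    (h0 : (0 : ℝ) ∈ S') (h0nn : ∀ η, 0 ≤ PlanarEigenmode.vorticity (v 0) η)
    (hΓ : 0 < ∫ y, PlanarEigenmode.vorticity (v 0) y) {s : ℝ} (hs : 0 ≤ s)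
    (hτs : (exp (l * R.A k * s) - 1) / (l * R.A k) ∈ S') {ε : ℝ} (hε : 0 < ε)
    (hclock : 2 * (∫ y, PlanarEigenmode.vorticity (v 0) y) *
        (∫ η, PlanarEigenmode.vorticity (v 0) η *
          Real.log (PlanarEigenmode.vorticity (v 0) η /
            ((∫ y, PlanarEigenmode.vorticity (v 0) y) / (4 * π * (l * R.A k)⁻¹) *
              exp (-(‖η‖ ^ 2 / (4 * (l * R.A k)⁻¹)))))) / ε ^ 2 ≤ exp (l * R.A k * s)) :
    ∫ η, |PlanarEigenmode.vorticity (v ((exp (l * R.A k * s) - 1) / (l * R.A k))) η -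
        (∫ y, PlanarEigenmode.vorticity (v 0) y) /
            (4 * π * ((exp (l * R.A k * s) - 1) / (l * R.A k) + (l * R.A k)⁻¹)) *
          exp (-(‖η‖ ^ 2 / (4 * ((exp (l * R.A k * s) - 1) / (l * R.A k) + (l * R.A k)⁻¹))))| ≤ ε := by
  have h := palasekTowerBreakdown_cosigned_L1_clock R k hl hS' hv hω hBS h0 h0nn hΓ hs hτs
  refine h.trans ?_
  set A : ℝ := 2 * (∫ y, PlanarEigenmode.vorticity (v 0) y) *
    ∫ η, PlanarEigenmode.vorticity (v 0) η *
      Real.log (PlanarEigenmode.vorticity (v 0) η /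
        ((∫ y, PlanarEigenmode.vorticity (v 0) y) / (4 * π * (l * R.A k)⁻¹) *
          exp (-(‖η‖ ^ 2 / (4 * (l * R.A k)⁻¹))))) with hA
  -- `√A · e^{−cs/2} ≤ ε ⇔ A e^{−cs} ≤ ε²`
  have hA' : A ≤ ε ^ 2 * exp (l * R.A k * s) := by
    rw [div_le_iff₀ (by positivity)] at hclock; linarith
  have hprod : Real.sqrt A * exp (-(l * R.A k * s / 2)) =
      Real.sqrt (A * exp (-(l * R.A k * s))) := by
    rw [Real.sqrt_mul' _ (exp_pos _).le, sqrt_exp_neg₀]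
  rw [hprod]
  calc Real.sqrt (A * exp (-(l * R.A k * s))) ≤ Real.sqrt (ε ^ 2) := by
        refine Real.sqrt_le_sqrt ?_
        rw [Real.exp_neg, ← div_eq_mul_inv, div_le_iff₀ (exp_pos _)]
        exact hA'
    _ = ε := Real.sqrt_sq hε.le

/-! ### §3 The three-dimensional reading -/

/-- **THE 3D `L¹` CLOCK, CO-SIGNED CLASS**: for the Lundgren child at constant rate `c = λA_k`
carrying the planar run `(ṽ, q̃)` of §1 (co-signed hand-over slice) and any jointly smooth passive
axial scalar `W̃`, on EVERY cross-section `{x₂ = z₀}` and at every strain time `s ≥ 0` of the window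
`S` (mapped into `S'` by Lundgren's clock),
**`∫ |ω_z(s, y, z₀) − ω_Burgers(y, z₀)| dy ≤ (2 Γ H(0))^{1/2} e^{−cs/2}`**, where
`ω_z = (curl u)₂ = e^{cs} ω̃(τ(s), e^{cs/2} y)` (`Lundgren.curl_lundgren_apply_two`) and `ω_Burgers =
burgersVorticity c 1 Γ`. [cite: GallayWayne2005, §3.4; Saffman1992, §13.3 eq. (29)] -/
theorem palasekTowerBreakdown_cosigned_childVorticity_L1_burgers_clock (R : TowerRates) (k : ℕ)
    {l : ℝ} (hl : 0 < l) (hS' : Convex ℝ S') (hv : IsClassicalNSSolutionOn S' 1 0 v q)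
    (hω : HasUniformRapidDecayOn S' (fun σ η => PlanarEigenmode.vorticity (v σ) η))
    (hBS : ∀ σ ∈ S', ∀ η, v σ η = biotSavart2D (PlanarEigenmode.vorticity (v σ)) η)
    (h0nn : ∀ η, 0 ≤ PlanarEigenmode.vorticity (v 0) η)
    (hΓ : 0 < ∫ y, PlanarEigenmode.vorticity (v 0) y)
    (hw : IsSmoothSpaceTimeOn S' w)
    (hmaps : MapsTo (fun t => (exp (l * R.A k * t) - 1) / (l * R.A k)) S S')
    (h0 : (0 : ℝ) ∈ S') {s : ℝ} (hsS : s ∈ S) (hs : 0 ≤ s) (z₀ : ℝ) :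
    ∫ y : EuclideanSpace ℝ (Fin 2),
        |curl (velocity (fun _ => l * R.A k)
            (fun t y => exp (l * R.A k * t / 2) •
              v ((exp (l * R.A k * t) - 1) / (l * R.A k)) (exp (l * R.A k * t / 2) • y))
            (fun t y => exp (-(l * R.A k * t)) •
              w ((exp (l * R.A k * t) - 1) / (l * R.A k)) (exp (l * R.A k * t / 2) • y)) s)
            (embedXY y + z₀ • eZ) 2 -
          burgersVorticity (l * R.A k) 1 (∫ y, PlanarEigenmode.vorticity (v 0) y) (embedXY y + z₀ • eZ)| ≤
      Real.sqrt (2 * (∫ y, PlanarEigenmode.vorticity (v 0) y) *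
        ∫ η, PlanarEigenmode.vorticity (v 0) η *
          Real.log (PlanarEigenmode.vorticity (v 0) η /
            ((∫ y, PlanarEigenmode.vorticity (v 0) y) / (4 * π * (l * R.A k)⁻¹) *
              exp (-(‖η‖ ^ 2 / (4 * (l * R.A k)⁻¹)))))) * exp (-(l * R.A k * s / 2)) := by
  set c : ℝ := l * R.A k with hc
  have hcpos : 0 < c := mul_pos hl (R.A_pos k)
  set a : ℝ := exp (c * s / 2) with ha
  have hapos : 0 < a := exp_pos _
  set τ : ℝ := (exp (c * s) - 1) / c with hτ
  set Γ : ℝ := ∫ y, PlanarEigenmode.vorticity (v 0) y with hΓdef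
  -- the planar `L¹` clock at Lundgren time `τ(s)`
  have hplanar := palasekTowerBreakdown_cosigned_L1_clock R k hl hS' hv hω hBS h0 h0nn hΓ hs
    (hmaps hsS)
  -- the integrand is `a² · |ω̃(τ) − g_τ|(a y)`
  set F : EuclideanSpace ℝ (Fin 2) → ℝ := fun η => |PlanarEigenmode.vorticity (v τ) η -
    Γ / (4 * π * (τ + c⁻¹)) * exp (-(‖η‖ ^ 2 / (4 * (τ + c⁻¹))))| with hF
  have hpt : ∀ y : EuclideanSpace ℝ (Fin 2),
      |curl (velocity (fun _ => c)
          (fun t y => exp (c * t / 2) • v ((exp (c * t) - 1) / c) (exp (c * t / 2) • y))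
          (fun t y => exp (-(c * t)) • w ((exp (c * t) - 1) / c) (exp (c * t / 2) • y)) s)
          (embedXY y + z₀ • eZ) 2 -
        burgersVorticity c 1 Γ (embedXY y + z₀ • eZ)| = a ^ 2 * F (a • y) := by
    intro y
    rw [curl_lundgren_apply_two (γ := fun _ => c) (a := fun t => exp (c * t / 2))
      (τ := fun t => (exp (c * t) - 1) / c) (d := fun t => exp (-(c * t))) hv.smooth_velocity hw hmaps
      hsS, projXY_add_smul_eZ, projXY_embedXY, burgersVorticity_eq_lundgren_gaussian hcpos.ne' Γ s z₀ y,
      hF]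
    dsimp only
    rw [← mul_sub, abs_mul, abs_of_pos (pow_pos hapos 2)]
  simp_rw [hpt]
  -- scale invariance of the planar `L¹` norm
  rw [integral_const_mul, Measure.integral_comp_smul volume F a, finrank_euclideanSpace_fin, smul_eq_mul,
    abs_of_pos (inv_pos.2 (pow_pos hapos 2)), ← mul_assoc, mul_inv_cancel₀ (pow_pos hapos 2).ne', one_mul]
  exact hplanar

end Summit.NavierStokesRegularity.FluidComputer.PalasekTowerClayBridge
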